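import Summits.AtomisticToContinuum.HydrodynamicLimit.Theorems.OneFlightGossipEngineEnergyCurrentTailsLevelCensusClosureBarrier
import Mathlib.Analysis.PSeries
import HarnessLib

/-!
# Census closure, arithmetic core III: the spallation classes of the pair majorant
# (stub C of the line `level-census-comparison`, crux `EnergyCurrentTails`, stmt-AtomisticToContinuum-9235)

Third measure-free file behind the registered stub `stub_censusClosure` (line lead's seat c2;
registered main theorem `census_spallSum_le`).  With the barrier of `…LevelCensusClosureBarrier` and
an abstract census majorant `nhi` (`0 ≤ nhi ≤ M`, Chebyshev, `≤ b + δ₀` above `E₀`), the SPALLATION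
part of the pair majorant of stub F2, `∑_{j=0}^{⌈E/Δ⌉} nhi((j−1)Δ) nhi(2E−(j+1)Δ)` (crosser in the
class `((j−1)Δ,(j+1)Δ]`, fast partner above `2E−(j+1)Δ`), is at most
`4e^{−L} M b(E) + 24 R M b(E) m₂/Δ + 3Mδ₀(⌈E/Δ⌉+1)` for `E ≥ E₀` (`spall_term_le`: `j ≤ 1` is
spallation onto a thermal partner, `∝ e^{−L}`; `2 ≤ j ≤ R` Chebyshev for the crosser; `j > R` two
barrier values whose exponentials multiply to `e^{−α(2E−2Δ)}`; `∑ 1/j² ≤ 2`).  Combined with the merge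
sum in `…LevelCensusClosureCore`.
-/

noncomputable section

open Real Finset

namespace Summit.AtomisticToContinuum.HydrodynamicLimit.Theorems.EnergyCurrentTailsLevelCensus

/-! ## The spallation classes `((j−1)Δ, (j+1)Δ] × (2E−(j+1)Δ, ∞)`, `0 ≤ j ≤ ⌈E/Δ⌉` -/

section Spallation

variable {M m₂ L Δ E₀ α β δ₀ : ℝ} {R : ℕ} {b nhi : ℝ → ℝ}

/-- Chebyshev for the fast partner in the boundary layer: if `w < E₀`, `3E/4 ≤ w`, `E ≥ E₀ ≥ 8Δ`
then `M m₂/w ≤ 4 b(E)`. -/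
theorem spall_cheb_le (hb : ∀ E, b E = β * M * Real.exp (-(α * E)) / E ^ 2) (hM : 0 < M)
    (hm₂ : 0 < m₂) (hL : 0 ≤ L) (hE₀ : 0 < E₀) (hα : α = L / E₀)
    (hβ : β = m₂ * Real.exp L * E₀) (hE₀Δ : 8 * Δ ≤ E₀) (hαΔ : α * Δ ≤ 1 / 8) {E w : ℝ}
    (hE : E₀ ≤ E) (hw : 0 < w) (hwE₀ : w < E₀) (hwE : E - 2 * Δ < w) :
    M * m₂ / w ≤ 4 * b E := by
  have hEpos : 0 < E := by linarith
  have hαnn : 0 ≤ α := by rw [hα]; positivity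
  have hβpos : 0 < β := by rw [hβ]; positivity
  have hbE : 0 < b E := barrier_pos hb hβpos hM hEpos.ne'
  have h := chebyshev_le_of_ratio hb hM hm₂ hE₀ hα hβ hEpos hw (κ₁ := 5 / 4) (κ₂ := 4 / 3)
    (ℓ := 1 / 4) ?_ (by linarith) (by linarith)
  · have exp_one_quarter_le : Real.exp (1 / 4) ≤ 3 / 2 := by
      have h := Real.abs_exp_sub_one_le (x := 1 / 4) (by rw [abs_le]; constructor <;> norm_num)
      rw [abs_le] at h; norm_num at h; linarith [h.2]
    calc M * m₂ / w ≤ Real.exp (1 / 4) * (5 / 4) ^ 2 * (4 / 3) * b E := h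
      _ ≤ 3 / 2 * (5 / 4) ^ 2 * (4 / 3) * b E := by gcongr
      _ ≤ 4 * b E := by nlinarith
  · calc α * (E - E₀) ≤ α * (2 * Δ) := mul_le_mul_of_nonneg_left (by linarith) hαnn
      _ ≤ 1 / 4 := by linarith

/-- Spallation class, both factors barrier values (`(j−1)Δ, w ≥ E₀`): the exponentials multiply to
`e^{−α(2E−2Δ)} ≤ e^{−L + 1/4} e^{−αE}`. -/
theorem spall_prod_bb_le (hb : ∀ E, b E = β * M * Real.exp (-(α * E)) / E ^ 2) (hβ : 0 < β)
    (hM : 0 < M) (hm₂ : 0 < m₂) (hΔ : 0 < Δ)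
    (hβMΔ : β * M / Δ ^ 2 = Real.exp L * M * (m₂ / Δ) * R)
    (hαΔ : α * Δ ≤ 1 / 8) {E i w : ℝ} (hE : 0 < E) (hi : 0 < i) (hw : 0 < w) (hαE : L ≤ α * E)
    (hsum : E - i * Δ - w = -E + 2 * Δ) (hw34 : 3 * E / 4 ≤ w) :
    b (i * Δ) * b w ≤ 4 * M * b E * (m₂ / Δ) * (R / i ^ 2) := by
  have hbE : 0 < b E := barrier_pos hb hβ hM hE.ne'
  have hiΔ : 0 < i * Δ := by positivity
  rw [barrier_mul_barrier hb hE.ne' hiΔ.ne' hw.ne', hsum]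
  have h2 : Real.exp (α * (-E + 2 * Δ)) ≤ 3 / 2 * Real.exp (-L) := by
    have h1 : α * (-E + 2 * Δ) = -(α * E) + 2 * (α * Δ) := by ring
    have exp_one_quarter_le : Real.exp (1 / 4) ≤ 3 / 2 := by
      have h := Real.abs_exp_sub_one_le (x := 1 / 4) (by rw [abs_le]; constructor <;> norm_num)
      rw [abs_le] at h; norm_num at h; linarith [h.2]
    calc Real.exp (α * (-E + 2 * Δ)) ≤ Real.exp (1 / 4 + -L) :=
          Real.exp_le_exp.2 (by rw [h1]; linarith)
      _ = Real.exp (1 / 4) * Real.exp (-L) := Real.exp_add _ _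
      _ ≤ 3 / 2 * Real.exp (-L) := mul_le_mul_of_nonneg_right exp_one_quarter_le (Real.exp_pos _).le
  have hEw : (E / w) ^ 2 ≤ 16 / 9 := by
    have h0 : 0 ≤ E / w := by positivity
    have h1 : E / w ≤ 4 / 3 := by rw [div_le_iff₀ hw]; linarith
    nlinarith
  have h3 : (E / (i * Δ * w)) ^ 2 ≤ 16 / 9 / (i * Δ) ^ 2 := by
    rw [mul_comm (i * Δ) w, ← div_div, div_pow]
    exact div_le_div_of_nonneg_right hEw (by positivity)
  have hkey : β * M * Real.exp (-L) / Δ ^ 2 = M * (m₂ / Δ) * R := by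
    rw [show β * M * Real.exp (-L) / Δ ^ 2 = Real.exp (-L) * (β * M / Δ ^ 2) by ring, hβMΔ,
      ← mul_assoc, ← mul_assoc, ← mul_assoc, ← Real.exp_add]
    simp
  calc b E * (β * M * Real.exp (α * (-E + 2 * Δ)) * (E / (i * Δ * w)) ^ 2)
      ≤ b E * (β * M * (3 / 2 * Real.exp (-L)) * (16 / 9 / (i * Δ) ^ 2)) := by
        apply mul_le_mul_of_nonneg_left _ hbE.le
        have h4 : β * M * Real.exp (α * (-E + 2 * Δ)) ≤ β * M * (3 / 2 * Real.exp (-L)) :=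
          mul_le_mul_of_nonneg_left h2 (by positivity)
        exact mul_le_mul h4 h3 (sq_nonneg _) (by positivity)
    _ = 8 / 3 * (β * M * Real.exp (-L) / Δ ^ 2) * b E * (1 / i ^ 2) := by
        field_simp; norm_num
    _ = 8 / 3 * M * b E * (m₂ / Δ) * (R / i ^ 2) := by rw [hkey]; field_simp
    _ ≤ 4 * M * b E * (m₂ / Δ) * (R / i ^ 2) := by
        have : 0 ≤ M * b E * (m₂ / Δ) * (R / i ^ 2) := by positivity
        nlinarith

/-- Spallation class, slow factor a barrier value with `α iΔ ≥ L`, fast factor `≤ 4 b(E)`: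
`b(iΔ) Y ≤ 4 M b(E) (m₂/Δ) R/i²`. -/
theorem spall_prod_bc_le (hb : ∀ E, b E = β * M * Real.exp (-(α * E)) / E ^ 2) (hβ : 0 < β)
    (hM : 0 < M) (hm₂ : 0 < m₂) (hΔ : 0 < Δ)
    (hβMΔ : β * M / Δ ^ 2 = Real.exp L * M * (m₂ / Δ) * R) {E i Y : ℝ} (hE : 0 < E)
    (hi : 0 < i) (hαi : L ≤ α * (i * Δ)) (hY0 : 0 ≤ Y) (hY : Y ≤ 4 * b E) :
    b (i * Δ) * Y ≤ 4 * M * b E * (m₂ / Δ) * (R / i ^ 2) := by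
  have hbE : 0 < b E := barrier_pos hb hβ hM hE.ne'
  have hiΔ : 0 < i * Δ := by positivity
  have hX : b (i * Δ) ≤ M * (m₂ / Δ) * (R / i ^ 2) := by
    rw [hb]
    have h1 : Real.exp (-(α * (i * Δ))) ≤ Real.exp (-L) := Real.exp_le_exp.2 (by linarith)
    have hkey : β * M * Real.exp (-L) / (i * Δ) ^ 2 = M * (m₂ / Δ) * (R / i ^ 2) := by
      rw [show β * M * Real.exp (-L) / (i * Δ) ^ 2 = Real.exp (-L) * (β * M / Δ ^ 2) * (1 / i ^ 2)
        by field_simp, hβMΔ, ← mul_assoc, ← mul_assoc, ← mul_assoc, ← Real.exp_add]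
      simp only [neg_add_cancel, Real.exp_zero, one_mul]
      ring
    calc β * M * Real.exp (-(α * (i * Δ))) / (i * Δ) ^ 2 ≤ β * M * Real.exp (-L) / (i * Δ) ^ 2 := by
          apply div_le_div_of_nonneg_right _ (by positivity)
          exact mul_le_mul_of_nonneg_left h1 (by positivity)
      _ = M * (m₂ / Δ) * (R / i ^ 2) := hkey
  have hX0 : 0 ≤ b (i * Δ) := (barrier_pos hb hβ hM hiΔ.ne').le
  calc b (i * Δ) * Y ≤ (M * (m₂ / Δ) * (R / i ^ 2)) * (4 * b E) := mul_le_mul hX hY hY0 (by positivity)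
    _ = 4 * M * b E * (m₂ / Δ) * (R / i ^ 2) := by ring

/-- **One spallation class.**  For `E ≥ E₀ = RΔ` (`R ≥ 8`, `8L ≤ R`, `m₂ ≤ Δ`) and
`0 ≤ j ≤ ⌈E/Δ⌉`: `nhi((j−1)Δ) nhi(2E−(j+1)Δ) ≤ 2e^{−L} M b(E) 𝟙{j ≤ 1}
+ 4 M b(E) (m₂/Δ) (𝟙{j ≤ R} + 𝟙{2 ≤ j} 4R/j²) + 3Mδ₀`. -/
theorem spall_term_le (hb : ∀ E, b E = β * M * Real.exp (-(α * E)) / E ^ 2) (hM : 1 ≤ M)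
    (hm₂ : 0 < m₂) (hL : 0 ≤ L) (hR8 : 8 ≤ (R : ℝ)) (hRL : 8 * L ≤ R) (hΔ : m₂ ≤ Δ)
    (hE₀ : E₀ = R * Δ) (hα : α = L / E₀) (hβ : β = m₂ * Real.exp L * E₀)
    (h0 : ∀ E', 0 ≤ nhi E') (h1 : ∀ E', nhi E' ≤ M) (h2 : ∀ E', 0 < E' → nhi E' ≤ M * m₂ / E')
    (h4 : ∀ E', E₀ ≤ E' → nhi E' ≤ b E' + δ₀) (hδ₀ : 0 ≤ δ₀) (hδM : δ₀ ≤ M)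
    {E : ℝ} (hE : E₀ ≤ E) {j : ℕ} (hjJ : j ≤ ⌈E / Δ⌉₊) :
    nhi (((j : ℝ) - 1) * Δ) * nhi (2 * E - ((j : ℝ) + 1) * Δ)
      ≤ 2 * Real.exp (-L) * M * b E * (if j ≤ 1 then (1 : ℝ) else 0)
        + 4 * M * b E * (m₂ / Δ) * ((if j ≤ R then (1 : ℝ) else 0)
            + (if 2 ≤ j then (1 : ℝ) else 0) * (4 * R / (j : ℝ) ^ 2)) + 3 * M * δ₀ := by
  -- common facts
  have hM0 : 0 < M := lt_of_lt_of_le one_pos hM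
  have hΔ0 : 0 < Δ := lt_of_lt_of_le hm₂ hΔ
  have hE₀8 : 8 * Δ ≤ E₀ := by rw [hE₀]; exact mul_le_mul_of_nonneg_right hR8 hΔ0.le
  have hE₀pos : 0 < E₀ := by linarith
  have hm₂E₀ : m₂ ≤ E₀ := by linarith
  have hEpos : 0 < E := by linarith
  have hβpos : 0 < β := by rw [hβ]; positivity
  have hαnn : 0 ≤ α := by rw [hα]; positivity
  have hαE₀ : α * E₀ = L := by rw [hα]; field_simp
  have hαE : L ≤ α * E := by rw [← hαE₀]; exact mul_le_mul_of_nonneg_left hE hαnn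
  have hαΔ : α * Δ ≤ 1 / 8 := by
    rw [hα, hE₀, div_mul_eq_mul_div, div_le_iff₀ (by positivity)]
    have := mul_le_mul_of_nonneg_right hRL hΔ0.le
    linarith
  have hJ : ((⌈E / Δ⌉₊ : ℕ) : ℝ) < E / Δ + 1 := Nat.ceil_lt_add_one (by positivity)
  have hjJ' : (j : ℝ) ≤ ⌈E / Δ⌉₊ := by exact_mod_cast hjJ
  have hj0 : (0 : ℝ) ≤ j := by positivity
  have hjΔ : ((j : ℝ) + 1) * Δ < E + 2 * Δ := by
    have h1 : ((j : ℝ) + 1) * Δ < (E / Δ + 2) * Δ := by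
      apply mul_lt_mul_of_pos_right _ hΔ0; linarith
    have h2 : (E / Δ + 2) * Δ = E + 2 * Δ := by field_simp
    linarith
  set w : ℝ := 2 * E - ((j : ℝ) + 1) * Δ with hwdef
  have hwE : E - 2 * Δ < w := by rw [hwdef]; linarith
  have hw34 : 3 * E / 4 ≤ w := by linarith
  have hwpos : 0 < w := by linarith
  have hbE : 0 < b E := barrier_pos hb hβpos hM0 hEpos.ne'
  have hβMΔ : β * M / Δ ^ 2 = Real.exp L * M * (m₂ / Δ) * R := by rw [hβ, hE₀]; field_simp
  have hC1 : 0 ≤ 2 * Real.exp (-L) * M * b E := by positivity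
  have hC2 : 0 ≤ 4 * M * b E * (m₂ / Δ) := by positivity
  have hind1 : 0 ≤ (if j ≤ 1 then (1 : ℝ) else 0) := by split_ifs <;> norm_num
  have hind2 : 0 ≤ (if j ≤ R then (1 : ℝ) else 0) := by split_ifs <;> norm_num
  have hind3 : 0 ≤ (if 2 ≤ j then (1 : ℝ) else 0) * (4 * R / (j : ℝ) ^ 2) := by
    split_ifs <;> positivity
  -- the fast partner: `nhi w ≤ Y + δ₀`, `Y ≤ M`, and `Y ≤ 4 b E` whenever `α (E - w) ≤ 1/8`
  have hYcheb : w < E₀ → M * m₂ / w ≤ 4 * b E := fun hwE₀ =>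
    spall_cheb_le hb hM0 hm₂ hL hE₀pos hα hβ hE₀8 hαΔ hE hwpos hwE₀ hwE
  have hsecond : α * (E - w) ≤ 1 / 8 →
      ∃ Y : ℝ, nhi w ≤ Y + δ₀ ∧ 0 ≤ Y ∧ Y ≤ M ∧ Y ≤ 4 * b E := by
    intro hℓ
    by_cases hwE₀ : E₀ ≤ w
    · refine ⟨b w, h4 _ hwE₀, (barrier_pos hb hβpos hM0 hwpos.ne').le,
        barrier_le_M hb hM0 hm₂ hm₂E₀ hα hβ hL hwE₀, ?_⟩
      have h := barrier_le_of_ratio hb hβpos hM0 hEpos hwpos (κ := 4 / 3) (ℓ := 1 / 8)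
        (by linarith) hℓ
      have exp_one_eighth_le : Real.exp (1 / 8) ≤ 5 / 4 := by
        have h := Real.abs_exp_sub_one_le (x := 1 / 8) (by rw [abs_le]; constructor <;> norm_num)
        rw [abs_le] at h; norm_num at h; linarith [h.2]
      calc b w ≤ Real.exp (1 / 8) * (4 / 3) ^ 2 * b E := h
        _ ≤ 5 / 4 * (4 / 3) ^ 2 * b E := by gcongr
        _ ≤ 4 * b E := by
            apply mul_le_mul_of_nonneg_right _ hbE.le; norm_num
    · push Not at hwE₀
      refine ⟨M * m₂ / w, by linarith [h2 w hwpos], by positivity, ?_, hYcheb hwE₀⟩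
      rw [div_le_iff₀ hwpos]; apply mul_le_mul_of_nonneg_left _ hM0.le; linarith
  by_cases hj1 : j ≤ 1
  · -- (o) `j ≤ 1`: slow factor `≤ M`, fast partner above `2E − 2Δ ≥ E`: `b w ≤ 2 e^{−L} b E`
    have hj1' : (j : ℝ) ≤ 1 := by exact_mod_cast hj1
    have hjΔ2 : ((j : ℝ) + 1) * Δ ≤ 2 * Δ := mul_le_mul_of_nonneg_right (by linarith) hΔ0.le
    have hwE' : E ≤ w := by rw [hwdef]; linarith
    have hwE₀ : E₀ ≤ w := hE.trans hwE'
    have hY : nhi w ≤ b w + δ₀ := h4 _ hwE₀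
    have hYM : b w ≤ M := barrier_le_M hb hM0 hm₂ hm₂E₀ hα hβ hL hwE₀
    have hY2 : b w ≤ 2 * Real.exp (-L) * b E := by
      have h := barrier_le_of_ratio hb hβpos hM0 hEpos hwpos (κ := 1) (ℓ := 1 / 4 + -L)
        (by linarith) ?_
      · rw [Real.exp_add] at h
        have exp_one_quarter_le : Real.exp (1 / 4) ≤ 3 / 2 := by
          have h := Real.abs_exp_sub_one_le (x := 1 / 4) (by rw [abs_le]; constructor <;> norm_num)
          rw [abs_le] at h; norm_num at h; linarith [h.2]
        calc b w ≤ Real.exp (1 / 4) * Real.exp (-L) * 1 ^ 2 * b E := h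
          _ ≤ 3 / 2 * Real.exp (-L) * 1 ^ 2 * b E := by gcongr
          _ = 3 / 2 * (Real.exp (-L) * b E) := by ring
          _ ≤ 2 * (Real.exp (-L) * b E) :=
              mul_le_mul_of_nonneg_right (by norm_num) (by positivity)
          _ = 2 * Real.exp (-L) * b E := by ring
      · have hEw : E - w ≤ -E + 2 * Δ := by rw [hwdef]; linarith
        have h3 := mul_le_mul_of_nonneg_left hEw hαnn
        have h4 : α * (-E + 2 * Δ) = -(α * E) + 2 * (α * Δ) := by ring
        linarith
    have hX : nhi (((j : ℝ) - 1) * Δ) ≤ M + δ₀ := by linarith [h1 (((j : ℝ) - 1) * Δ)]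
    have hp := mul_le_mul_add_three (h0 _) (h0 w) hX hY le_rfl hYM hδ₀ hδM
    rw [if_pos hj1]
    have h5 := mul_le_mul_of_nonneg_left hY2 hM0.le
    have h6 := mul_nonneg hC2 (add_nonneg hind2 hind3)
    have h8 : M * (2 * Real.exp (-L) * b E) = 2 * Real.exp (-L) * M * b E * 1 := by ring
    linarith
  · push Not at hj1
    rw [if_neg (show ¬ (j ≤ 1) by omega), if_pos (show 2 ≤ j by omega)]
    have hj2 : (2 : ℝ) ≤ j := by exact_mod_cast hj1
    set i : ℝ := (j : ℝ) - 1 with hidef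
    have hi1 : 1 ≤ i := by rw [hidef]; linarith
    have hi0 : 0 < i := by linarith
    have hiΔ : 0 < i * Δ := by positivity
    have hij : (R : ℝ) / i ^ 2 ≤ 4 * R / (j : ℝ) ^ 2 := by
      rw [div_le_div_iff₀ (by positivity) (by positivity)]
      have hj2i : (j : ℝ) ≤ 2 * i := by rw [hidef]; linarith
      have hsq : (j : ℝ) ^ 2 ≤ (2 * i) ^ 2 := pow_le_pow_left₀ hj0 hj2i 2
      have hR0 : 0 ≤ (R : ℝ) := by linarith
      have h := mul_le_mul_of_nonneg_left hsq hR0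
      have h' : (R : ℝ) * (2 * i) ^ 2 = 4 * R * i ^ 2 := by ring
      linarith
    by_cases hjR : j ≤ R
    · -- (i) `2 ≤ j ≤ R`: slow factor Chebyshev `≤ M m₂/Δ`, fast partner `≤ 4 b E`
      rw [if_pos hjR]
      have hjR' : (j : ℝ) ≤ R := by exact_mod_cast hjR
      have hℓ : α * (E - w) ≤ 1 / 8 := by
        have : E - w ≤ Δ := by
          have h := mul_le_mul_of_nonneg_right (show (j : ℝ) + 1 ≤ R + 1 by linarith) hΔ0.le
          rw [hwdef]; rw [hE₀] at hE; linarith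
        calc α * (E - w) ≤ α * Δ := mul_le_mul_of_nonneg_left this hαnn
          _ ≤ 1 / 8 := hαΔ
      obtain ⟨Y, hY, hY0, hYM, hY4⟩ := hsecond hℓ
      have hX : nhi (i * Δ) ≤ M * m₂ / (i * Δ) + δ₀ := by linarith [h2 _ hiΔ]
      have hmi : m₂ ≤ i * Δ := hΔ.trans (le_mul_of_one_le_left hΔ0.le hi1)
      have hXM : M * m₂ / (i * Δ) ≤ M := by
        rw [div_le_iff₀ hiΔ]; exact mul_le_mul_of_nonneg_left hmi hM0.le
      have hXΔ : M * m₂ / (i * Δ) ≤ M * (m₂ / Δ) := by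
        rw [mul_div_assoc]
        apply mul_le_mul_of_nonneg_left _ hM0.le
        exact div_le_div_of_nonneg_left hm₂.le hΔ0 (le_mul_of_one_le_left hΔ0.le hi1)
      have hp := mul_le_mul_add_three (h0 _) (h0 w) hX hY hXM hYM hδ₀ hδM
      have hq : M * m₂ / (i * Δ) * Y ≤ (M * (m₂ / Δ)) * (4 * b E) :=
        mul_le_mul hXΔ hY4 hY0 (by positivity)
      have h6 : 0 ≤ 4 * M * b E * (m₂ / Δ) * (4 * R / (j : ℝ) ^ 2) := by positivity
      have h8 : (M * (m₂ / Δ)) * (4 * b E) = 4 * M * b E * (m₂ / Δ) := by ring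
      have h9 : 2 * Real.exp (-L) * M * b E * 0 + 4 * M * b E * (m₂ / Δ)
            * (1 + 1 * (4 * R / (j : ℝ) ^ 2)) + 3 * M * δ₀
          = 4 * M * b E * (m₂ / Δ) + 4 * M * b E * (m₂ / Δ) * (4 * R / (j : ℝ) ^ 2)
            + 3 * M * δ₀ := by ring
      rw [h9]
      linarith
    · -- (ii) `j ≥ R + 1`: slow factor a barrier value with `α (j-1)Δ ≥ L`
      rw [if_neg hjR]
      push Not at hjR
      have hjR' : (R : ℝ) + 1 ≤ j := by exact_mod_cast hjR
      have hiE₀ : E₀ ≤ i * Δ := by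
        rw [hE₀]; exact mul_le_mul_of_nonneg_right (by rw [hidef]; linarith) hΔ0.le
      have hαi : L ≤ α * (i * Δ) := by rw [← hαE₀]; exact mul_le_mul_of_nonneg_left hiE₀ hαnn
      have hX : nhi (i * Δ) ≤ b (i * Δ) + δ₀ := h4 _ hiE₀
      have hXM : b (i * Δ) ≤ M := barrier_le_M hb hM0 hm₂ hm₂E₀ hα hβ hL hiE₀
      have hprod : ∃ Y : ℝ, nhi w ≤ Y + δ₀ ∧ Y ≤ M ∧
          b (i * Δ) * Y ≤ 4 * M * b E * (m₂ / Δ) * (R / i ^ 2) := by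
        by_cases hwE₀ : E₀ ≤ w
        · refine ⟨b w, h4 _ hwE₀, barrier_le_M hb hM0 hm₂ hm₂E₀ hα hβ hL hwE₀, ?_⟩
          exact spall_prod_bb_le hb hβpos hM0 hm₂ hΔ0 hβMΔ hαΔ hEpos hi0 hwpos hαE
            (by rw [hwdef, hidef]; ring) hw34
        · push Not at hwE₀
          refine ⟨M * m₂ / w, by linarith [h2 w hwpos], ?_, ?_⟩
          · rw [div_le_iff₀ hwpos]; apply mul_le_mul_of_nonneg_left _ hM0.le; linarith
          · exact spall_prod_bc_le hb hβpos hM0 hm₂ hΔ0 hβMΔ hEpos hi0 hαi (by positivity)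
              (hYcheb hwE₀)
      obtain ⟨Y, hY, hYM, hXY⟩ := hprod
      have hp := mul_le_mul_add_three (h0 _) (h0 w) hX hY hXM hYM hδ₀ hδM
      have hq := mul_le_mul_of_nonneg_left hij hC2
      have h9 : 2 * Real.exp (-L) * M * b E * 0 + 4 * M * b E * (m₂ / Δ)
            * (0 + 1 * (4 * R / (j : ℝ) ^ 2)) + 3 * M * δ₀
          = 4 * M * b E * (m₂ / Δ) * (4 * R / (j : ℝ) ^ 2) + 3 * M * δ₀ := by ring
      rw [h9]
      linarith

/-- `#{j ≤ J : j ≤ 1} ≤ 2`, as a real sum of indicators. -/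
theorem sum_range_indicator_le_two (J : ℕ) :
    ∑ j ∈ Finset.range (J + 1), (if j ≤ 1 then (1 : ℝ) else 0) ≤ 2 := by
  rw [Finset.sum_boole]
  have h : ((Finset.range (J + 1)).filter (fun j => j ≤ 1)).card ≤ (Finset.range 2).card := by
    apply Finset.card_le_card
    intro x hx
    simp only [Finset.mem_filter, Finset.mem_range] at hx ⊢
    omega
  rw [Finset.card_range] at h
  exact_mod_cast h

/-- `#{j ≤ J : j ≤ R} ≤ R + 1`, as a real sum of indicators. -/
theorem sum_range_indicator_le_succ (J R : ℕ) :
    ∑ j ∈ Finset.range (J + 1), (if j ≤ R then (1 : ℝ) else 0) ≤ R + 1 := by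
  rw [Finset.sum_boole]
  have h : ((Finset.range (J + 1)).filter (fun j => j ≤ R)).card ≤ (Finset.range (R + 1)).card := by
    apply Finset.card_le_card
    intro x hx
    simp only [Finset.mem_filter, Finset.mem_range] at hx ⊢
    omega
  rw [Finset.card_range] at h
  exact_mod_cast h

/-- `∑_{2 ≤ j ≤ J} 4R/j² ≤ 4R`. -/
theorem sum_range_inv_sq_le (J R : ℕ) :
    ∑ j ∈ Finset.range (J + 1), (if 2 ≤ j then (1 : ℝ) else 0) * (4 * R / (j : ℝ) ^ 2)
      ≤ 4 * (R : ℝ) := by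
  simp_rw [ite_mul, one_mul, zero_mul]
  rw [← Finset.sum_filter]
  have h : (Finset.range (J + 1)).filter (fun j => 2 ≤ j) = Finset.Ioo 1 (J + 1) := by
    ext x; simp only [Finset.mem_filter, Finset.mem_range, Finset.mem_Ioo]; omega
  rw [h]
  have h2 := sum_Ioo_inv_sq_le (α := ℝ) 1 (J + 1)
  have h3 : ∑ j ∈ Finset.Ioo 1 (J + 1), (4 * R / (j : ℝ) ^ 2)
      = 4 * R * ∑ j ∈ Finset.Ioo 1 (J + 1), ((j : ℝ) ^ 2)⁻¹ := by
    rw [Finset.mul_sum]; simp_rw [div_eq_mul_inv]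
  rw [h3]
  have hR : 0 ≤ (4 : ℝ) * R := by positivity
  have h4 := mul_le_mul_of_nonneg_left h2 hR
  norm_num at h4
  linarith

/-- **The spallation sum (registered main theorem of this file, `∀`-form)**: for `E ≥ E₀ = RΔ`
(`R ≥ 8`, `8L ≤ R`, `m₂ ≤ Δ`),
`∑_{j=0}^{⌈E/Δ⌉} nhi((j−1)Δ) nhi(2E−(j+1)Δ) ≤ 4e^{−L} M b(E) + 24 R M b(E) m₂/Δ + 3Mδ₀ (⌈E/Δ⌉+1)`. -/
theorem census_spallSum_le :
    ∀ (M m₂ L Δ E₀ α β δ₀ : ℝ) (R : ℕ) (b nhi : ℝ → ℝ),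
      (∀ E, b E = β * M * Real.exp (-(α * E)) / E ^ 2) → 1 ≤ M → 0 < m₂ → 0 ≤ L →
      8 ≤ (R : ℝ) → 8 * L ≤ R → m₂ ≤ Δ → E₀ = R * Δ → α = L / E₀ →
      β = m₂ * Real.exp L * E₀ → (∀ E', 0 ≤ nhi E') → (∀ E', nhi E' ≤ M) →
      (∀ E', 0 < E' → nhi E' ≤ M * m₂ / E') → (∀ E', E₀ ≤ E' → nhi E' ≤ b E' + δ₀) →
      0 ≤ δ₀ → δ₀ ≤ M → ∀ E : ℝ, E₀ ≤ E →
        ∑ j ∈ Finset.range (⌈E / Δ⌉₊ + 1), nhi (((j : ℝ) - 1) * Δ) * nhi (2 * E - ((j : ℝ) + 1) * Δ)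
          ≤ 4 * Real.exp (-L) * M * b E + 24 * R * M * b E * (m₂ / Δ)
            + 3 * M * δ₀ * (⌈E / Δ⌉₊ + 1) := by
  intro M m₂ L Δ E₀ α β δ₀ R b nhi hb hM hm₂ hL hR8 hRL hΔ hE₀ hα hβ h0 h1 h2 h4 hδ₀ hδM E hE
  set J : ℕ := ⌈E / Δ⌉₊ with hJ
  set C1 : ℝ := 2 * Real.exp (-L) * M * b E with hC1
  set C2 : ℝ := 4 * M * b E * (m₂ / Δ) with hC2
  have hM0 : 0 < M := lt_of_lt_of_le one_pos hM
  have hΔ0 : 0 < Δ := lt_of_lt_of_le hm₂ hΔ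
  have hE₀pos : 0 < E₀ := by rw [hE₀]; exact mul_pos (by linarith) hΔ0
  have hEpos : 0 < E := by linarith
  have hβpos : 0 < β := by rw [hβ]; positivity
  have hbE : 0 < b E := barrier_pos hb hβpos hM0 hEpos.ne'
  have hC10 : 0 ≤ C1 := by positivity
  have hC20 : 0 ≤ C2 := by positivity
  have hR1 : (1 : ℝ) ≤ R := by linarith
  calc ∑ j ∈ Finset.range (J + 1), nhi (((j : ℝ) - 1) * Δ) * nhi (2 * E - ((j : ℝ) + 1) * Δ)
      ≤ ∑ j ∈ Finset.range (J + 1), (C1 * (if j ≤ 1 then (1 : ℝ) else 0)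
          + C2 * ((if j ≤ R then (1 : ℝ) else 0)
            + (if 2 ≤ j then (1 : ℝ) else 0) * (4 * R / (j : ℝ) ^ 2)) + 3 * M * δ₀) := by
        refine Finset.sum_le_sum fun j hj => ?_
        rw [Finset.mem_range] at hj
        exact spall_term_le hb hM hm₂ hL hR8 hRL hΔ hE₀ hα hβ h0 h1 h2 h4 hδ₀ hδM hE (by omega)
    _ = C1 * (∑ j ∈ Finset.range (J + 1), (if j ≤ 1 then (1 : ℝ) else 0))
        + C2 * ((∑ j ∈ Finset.range (J + 1), (if j ≤ R then (1 : ℝ) else 0))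
          + ∑ j ∈ Finset.range (J + 1), (if 2 ≤ j then (1 : ℝ) else 0) * (4 * R / (j : ℝ) ^ 2))
        + 3 * M * δ₀ * (J + 1) := by
        rw [Finset.sum_add_distrib, Finset.sum_add_distrib, Finset.sum_const, Finset.card_range,
          ← Finset.mul_sum, ← Finset.mul_sum, Finset.sum_add_distrib]
        ring
    _ ≤ C1 * 2 + C2 * ((R + 1) + 4 * R) + 3 * M * δ₀ * (J + 1) := by
        have ha := mul_le_mul_of_nonneg_left (sum_range_indicator_le_two J) hC10
        have hb' := mul_le_mul_of_nonneg_left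
          (add_le_add (sum_range_indicator_le_succ J R) (sum_range_inv_sq_le J R)) hC20
        linarith
    _ ≤ 4 * Real.exp (-L) * M * b E + 24 * R * M * b E * (m₂ / Δ) + 3 * M * δ₀ * (J + 1) := by
        rw [hC1, hC2]
        have : 0 ≤ 4 * M * b E * (m₂ / Δ) * (R - 1) := by
          apply mul_nonneg (by positivity); linarith
        nlinarith


end Spallation


end Summit.AtomisticToContinuum.HydrodynamicLimit.Theorems.EnergyCurrentTailsLevelCensus

end
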